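import Literature.Barriers.CriticalPhenomena.LaceExpansionIsingDeconvolutionThm17Refuted
import Literature.Barriers.CriticalPhenomena.LaceExpansionIsingGreenComparisonSymbols
import Literature.MathematicalPhysics.QuantumLattice.TorusTestPotential
import Mathlib.Analysis.SpecialFunctions.Gamma.Basic
import Mathlib.Analysis.SpecialFunctions.Trigonometric.Series
import HarnessLib

/-!
# The spread-out random walk two-point function along Hara–van der Hofstad–Slade 2003, §6:
# heat kernel, large deviations, and the sharp Gaussian asymptotics of `S_1` at each fixed `L`

Barrier catalogue `Literature/Barriers/CriticalPhenomena/` (D-0021), analysis support for the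
spread-out Ising programme (`LaceExpansionIsingDeconvolution.lean`: Sakai 2007, Thm. 1.3 through
Liu–Slade's Theorem 1.7). Sakai's Theorem 1.3 is proved in the source "following the
model-independent analysis of the lace expansion in [h05, hhs03]"; this file formalises the
random-walk input of that analysis — Hara–van der Hofstad–Slade 2003, Proposition 1.3.1 and its
proof in §6 — for Sakai's uniformly spread-out step distribution `D = soStep d L`
(`S_μ = Σ_n μⁿD^{*n} = soGreen d L μ`, `σ² = soVariance d L`, `a_d = gaussianAmp d`). The first
display of Prop. 1.3.1, the `L`-uniform upper bound `S_μ(x) ≤ δ_{0,x} + O(L^{-2+α}⟦x⟧^{2-d})`, is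
already a theorem of the tree (`LiuSlade2026_prop12_greenBound_holds`); here:

* Part 1 — the heat kernel `I_{t,μ}(x) = e^{-t} Σ_{n ≥ 0} (tμ)ⁿ/n! · D^{*n}(x)` ((6.11) of the
  source, there derived from the Fourier definition (6.8); here it is the definition,
  `soHeat d L μ t x`), its nonnegativity, monotonicity in `μ`, and `I_{t,μ} ≤ 1`;
* Part 2 — the exponential moment identity `Σ_x e^{s x_i} D^{*n}(x) = φ_i(s)ⁿ`,
  `φ_i(s) = Σ_y D(y) e^{s y_i} = Σ_y D(y) cosh(s y_i)` ((6.13)–(6.14)) and the resulting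
  **large-deviation bound, Lemma 6.4.2** ((6.12)): `I_{t,μ}(x) ≤ exp(-s|x_i| + tσ²s²/d)` for
  `0 ≤ s ≤ 1/L`, whence `I_{t,μ}(x) ≤ exp(-|x_i|/L + σ²t/(dL²))` and, for `t ≥ dL|x_i|/(2σ²)`,
  `I_{t,μ}(x) ≤ exp(-d x_i²/(4σ²t))` (`0 ≤ μ ≤ 1`);
* Part 3 — continuity in `t` and the **small-time bound, Lemma 6.4.1**, in the form
  `∫₀ᵀ I_{t,μ}(x) dt ≤ T (e^{-|x_i|/(2L)} + e^{-d x_i²/(4σ²T)})` (`0 ≤ μ ≤ 1`, `T > 0`, any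
  coordinate `i`), which is what the source's proof gives before its final comparison of
  exponentials with powers;
* Part 4 — the time integral `∫₀^∞ I_{t,μ}(x) dt = S_μ(x)` ((6.9)) for `0 ≤ μ ≤ 1` in `d ≥ 3`
  (term by term: `∫₀^∞ e^{-t}tⁿ/n! dt = 1`), with the integrability of `t ↦ I_{t,μ}(x)`;
* Part 5 — the Fourier representation (6.8), `I_{t,μ}(x) = (2π)^{-d}∫ cos(k·x)e^{-t[1-μD̂(k)]}dk`,
  and the identification `I_{t,μ} = Re I_t[μD]` with Hara's heat kernel `haraI` of the tree;
* Part 6 — **the second display of Prop. 1.3.1 at each fixed `L`**: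
  `S_1(x) = (a_d/σ²)|x|^{2-d} + O_L(|x|^{-(d-α)})` for every `α > 0`, `d ≥ 3`, `L ≥ 1`
  (`soGreen_one_asymp_sharp`). The error exponent `d - α` is what the error term of Sakai's
  theorem requires; Hara's Gaussian lemma as vendored (`Hara2008_thm13`, error
  `|x|^{-(d-2+2/d)}`) is too weak, and the improvement is exactly the source's §6.4–§6.5: the
  small-time part of `S_1(x) = ∫₀^∞ I_t(x)dt` is controlled by large deviations (Lemma 6.4.1)
  instead of Hara's Lemma 2.3, while the large-time part uses Hara 2008, Lemma 2.2 (a theorem of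
  the tree, `Hara2008_lem22_holds`, playing the role of the source's Lemma 6.3.1): with
  `T = |x|^{2-δ}`, `δ = 2α/d`, `∫₀ᵀ I_t ≤ 2Te^{-c₀|x|^δ}`,
  `∫_T^∞|I_t - p_t| ≤ c∫_T^∞ t^{-(d+2)/2} = (2c/d)|x|^{-(d-α)}`, `∫₀^∞ p_t = (a_d/σ²)|x|^{2-d}`,
  `∫₀ᵀ p_t ≤ Tp_T ≤ A₀Te^{-d|x|^δ/(2σ²)}` for `|x|^δ ≥ σ²` (monotonicity of `t ↦ t^{-d/2}e^{-a/t}`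
  before its maximum, for the source's (6.18)–(6.19)), and the finitely many `x` below the
  thresholds are absorbed into the constant. (The `L`-uniform form of the source's error term is
  not needed downstream and is not claimed.)

All statements are theorems; no named fact is introduced.

## References

* T. Hara, R. van der Hofstad, G. Slade, *Critical two-point functions and the lace expansion for
  spread-out high-dimensional percolation and related models*, Ann. Probab. 31 (2003) 349–408,
  arXiv:math-ph/0011046: Prop. 1.3.1; §6.2 (the integral representation (6.8)–(6.9), `S^<_μ`,
  `S^>_μ`, `T_x`); Lemma 6.3.1; §6.4 (Lemma 6.4.1, Lemma 6.4.2 and their proofs, (6.10)–(6.16));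
  §6.5 ((6.17)–(6.19)) [HaraHofstadSlade2003]. (Display numbers are those of the arXiv version
  held in the literature store, counted within §6.)
* T. Hara, *Decay of correlations in nearest-neighbor self-avoiding walk, percolation, lattice
  trees and animals*, Ann. Probab. 36 (2008) 530–593: §2.1 (2.2), Lemma 2.2 and §2.6 [Hara2008].
* A. Sakai, *Lace expansion for the Ising model*, Comm. Math. Phys. 272 (2007) 283–344: Thm. 1.3
  and its proof ("following the model-independent analysis of … [hhs03]"), (1.19) [Sakai2007].
-/

noncomputable section

namespace Literature.Barriers.CriticalPhenomena.SpreadOutIsing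

open Filter Finset Literature.Probability.LatticeModels
open _root_.MeasureTheory _root_.Topology
open scoped BigOperators

variable {d L : ℕ}

/-! ## Part 1. The heat kernel as a series -/

/-- The heat kernel of the spread-out walk at "time" `t` and fugacity `μ`:
`I_{t,μ}(x) = e^{-t} Σ_{n ≥ 0} (tμ)ⁿ/n! · D^{*n}(x)` (Hara–van der Hofstad–Slade 2003, (6.11);
for `μ = 1` the law at time `t` of the continuous-time walk with jump distribution `D`).
[cite: HaraHofstadSlade2003, §6.4 (6.11)] -/
def soHeat (d L : ℕ) (μ t : ℝ) (x : Site d) : ℝ :=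
  Real.exp (-t) * ∑' n : ℕ, (t * μ) ^ n / (n.factorial : ℝ) * convPow (soStep d L) n x

/-- The terms of the heat-kernel series are dominated by the exponential series:
`|(tμ)ⁿ/n! · D^{*n}(x)| ≤ |tμ|ⁿ/n!` (`0 ≤ D^{*n} ≤ 1`). [cite: HaraHofstadSlade2003, §6.4 ("0 ≤ D^{*n}(x) ≤ 1 for all n")] -/
theorem abs_soHeat_term_le (μ t : ℝ) (n : ℕ) (x : Site d) :
    |(t * μ) ^ n / (n.factorial : ℝ) * convPow (soStep d L) n x| ≤ |t * μ| ^ n / (n.factorial : ℝ) := by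
  rw [abs_mul, abs_div, abs_pow, Nat.abs_cast, abs_of_nonneg (convPow_nonneg n x)]
  exact mul_le_of_le_one_right (by positivity) (convPow_le_one n x)

/-- The heat-kernel series converges absolutely. [cite: HaraHofstadSlade2003, §6.4 (6.11)] -/
theorem summable_soHeat_terms (μ t : ℝ) (x : Site d) :
    Summable fun n : ℕ => (t * μ) ^ n / (n.factorial : ℝ) * convPow (soStep d L) n x := by
  refine Summable.of_norm_bounded (g := fun n : ℕ => |t * μ| ^ n / (n.factorial : ℝ))
    (Real.summable_pow_div_factorial _) fun n => ?_
  rw [Real.norm_eq_abs]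
  exact abs_soHeat_term_le μ t n x

/-- `I_{t,μ}(x) ≥ 0` for `μ, t ≥ 0` ("this representation immediately implies the non-negativity
of `I_{t,μ}(x)`"). [cite: HaraHofstadSlade2003, §6.4 (after (6.11))] -/
theorem soHeat_nonneg {μ t : ℝ} (hμ : 0 ≤ μ) (ht : 0 ≤ t) (x : Site d) : 0 ≤ soHeat d L μ t x :=
  mul_nonneg (Real.exp_pos _).le (tsum_nonneg fun n =>
    mul_nonneg (div_nonneg (pow_nonneg (mul_nonneg ht hμ) n) (Nat.cast_nonneg _)) (convPow_nonneg n x))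

/-- `I_{t,μ}(x)` is non-decreasing in `μ ≥ 0` (for `t ≥ 0`) ("… together with its monotonicity
in `μ`"). [cite: HaraHofstadSlade2003, §6.4 (after (6.11))] -/
theorem soHeat_mono {μ ν t : ℝ} (hμ : 0 ≤ μ) (hμν : μ ≤ ν) (ht : 0 ≤ t) (x : Site d) :
    soHeat d L μ t x ≤ soHeat d L ν t x := by
  unfold soHeat
  refine mul_le_mul_of_nonneg_left ?_ (Real.exp_pos _).le
  refine Summable.tsum_le_tsum (fun n => ?_) (summable_soHeat_terms μ t x) (summable_soHeat_terms ν t x)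
  refine mul_le_mul_of_nonneg_right ?_ (convPow_nonneg n x)
  refine div_le_div_of_nonneg_right ?_ (Nat.cast_nonneg _)
  exact pow_le_pow_left₀ (mul_nonneg ht hμ) (mul_le_mul_of_nonneg_left hμν ht) n

/-- The trivial bound `I_{t,μ}(x) ≤ e^{-t}e^{t|μ|}`; in particular `I_{t,μ} ≤ 1` for
`0 ≤ μ ≤ 1`, `t ≥ 0`. [cite: HaraHofstadSlade2003, §6.4 (6.11)] -/
theorem soHeat_le_exp {μ t : ℝ} (x : Site d) :
    soHeat d L μ t x ≤ Real.exp (-t) * Real.exp (|t * μ|) := by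
  unfold soHeat
  refine mul_le_mul_of_nonneg_left ?_ (Real.exp_pos _).le
  have h := (summable_soHeat_terms (d := d) (L := L) μ t x)
  have hexp : HasSum (fun n : ℕ => |t * μ| ^ n / (n.factorial : ℝ)) (Real.exp |t * μ|) := by
    rw [Real.exp_eq_exp_ℝ]
    exact NormedSpace.expSeries_div_hasSum_exp |t * μ|
  calc ∑' n : ℕ, (t * μ) ^ n / (n.factorial : ℝ) * convPow (soStep d L) n x
      ≤ ∑' n : ℕ, |t * μ| ^ n / (n.factorial : ℝ) :=
        Summable.tsum_le_tsum (fun n => (le_abs_self _).trans (abs_soHeat_term_le μ t n x)) h hexp.summable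
    _ = Real.exp |t * μ| := hexp.tsum_eq

/-- `I_{t,μ}(x) ≤ 1` for `0 ≤ μ ≤ 1` and `t ≥ 0`. [cite: HaraHofstadSlade2003, §6.4 (6.11)] -/
theorem soHeat_le_one {μ t : ℝ} (hμ : 0 ≤ μ) (hμ1 : μ ≤ 1) (ht : 0 ≤ t) (x : Site d) :
    soHeat d L μ t x ≤ 1 := by
  refine (soHeat_le_exp x).trans ?_
  rw [← Real.exp_add]
  refine Real.exp_le_one_iff.2 ?_
  rw [abs_of_nonneg (mul_nonneg ht hμ)]
  nlinarith

/-! ## Part 2. Exponential moments and the large-deviation bound (Lemma 6.4.2) -/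

/-- The exponential moment of the step distribution in the `i`-th coordinate direction,
`φ_i(s) = Σ_y D(y) e^{s y_i}` (a finite sum over the neighbourhood of the origin).
[cite: HaraHofstadSlade2003, §6.4 (6.14) (Σ_x e^{s x_1} D(x))] -/
def soStepMGF (d L : ℕ) (i : Fin d) (s : ℝ) : ℝ :=
  ∑ y ∈ (spreadOutGraph d L).neighborFinset 0, soStep d L y * Real.exp (s * ((y i : ℤ) : ℝ))

/-- `φ_i(s) ≥ 0`. [folklore] -/
theorem soStepMGF_nonneg (i : Fin d) (s : ℝ) : 0 ≤ soStepMGF d L i s :=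
  Finset.sum_nonneg fun y _ => mul_nonneg (soStep_nonneg y) (Real.exp_pos _).le

/-- **The exponential moment of `D^{*n}` is `φ_i(s)ⁿ`**:
`Σ_x e^{s x_i} D^{*n}(x) = (Σ_y e^{s y_i} D(y))ⁿ` ("interchanging sums in (6.11) …
`Σ_x e^{s x_1} D^{*n}(x) = [Σ_x e^{s x_1} D(x)]ⁿ`"), as a `HasSum` statement (so that no
description of the support of `D^{*n}` is needed: induction on `n`, with
`D^{*(n+1)}(w) = Σ_y D(y) D^{*n}(w - y)` and translation invariance of sums over `ℤ^d`).
[cite: HaraHofstadSlade2003, §6.4, proof of Lemma 6.4.2 ((6.14) and the display after it)] -/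
theorem hasSum_exp_mul_convPow (i : Fin d) (s : ℝ) (n : ℕ) :
    HasSum (fun x : Site d => Real.exp (s * ((x i : ℤ) : ℝ)) * convPow (soStep d L) n x)
      (soStepMGF d L i s ^ n) := by
  induction n with
  | zero =>
    have h : ∀ x : Site d, x ≠ 0 → Real.exp (s * ((x i : ℤ) : ℝ)) * convPow (soStep d L) 0 x = 0 := by
      intro x hx
      show Real.exp (s * ((x i : ℤ) : ℝ)) * delta0 x = 0
      rw [delta0_of_ne_zero hx, mul_zero]
    have h0 := hasSum_single (f := fun x : Site d => Real.exp (s * ((x i : ℤ) : ℝ)) * convPow (soStep d L) 0 x) 0 h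
    have hval : Real.exp (s * (((0 : Site d) i : ℤ) : ℝ)) * convPow (soStep d L) 0 0 = 1 := by
      show Real.exp (s * (((0 : Site d) i : ℤ) : ℝ)) * delta0 (0 : Site d) = 1
      simp
    rw [hval] at h0
    simpa using h0
  | succ n ih =>
    -- `e^{s w_i} D^{*(n+1)}(w) = Σ_y [D(y) e^{s y_i}] · [e^{s (w-y)_i} D^{*n}(w - y)]`
    have hrepr : ∀ w : Site d, Real.exp (s * ((w i : ℤ) : ℝ)) * convPow (soStep d L) (n + 1) w =
        ∑ y ∈ (spreadOutGraph d L).neighborFinset 0, (soStep d L y * Real.exp (s * ((y i : ℤ) : ℝ))) *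
          (Real.exp (s * (((w - y) i : ℤ) : ℝ)) * convPow (soStep d L) n (w - y)) := by
      intro w
      rw [convPow_succ_eq_sum, sum_neighborFinset_reindex, Finset.mul_sum]
      refine Finset.sum_congr rfl fun y _ => ?_
      have he : Real.exp (s * ((w i : ℤ) : ℝ)) =
          Real.exp (s * ((y i : ℤ) : ℝ)) * Real.exp (s * (((w - y) i : ℤ) : ℝ)) := by
        rw [← Real.exp_add, Pi.sub_apply, Int.cast_sub]; ring_nf
      rw [he]; ring
    -- each summand has sum `D(y) e^{s y_i} φⁿ` by translation invariance
    have hterm : ∀ y ∈ (spreadOutGraph d L).neighborFinset 0,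
        HasSum (fun w : Site d => (soStep d L y * Real.exp (s * ((y i : ℤ) : ℝ))) *
          (Real.exp (s * (((w - y) i : ℤ) : ℝ)) * convPow (soStep d L) n (w - y)))
          ((soStep d L y * Real.exp (s * ((y i : ℤ) : ℝ))) * soStepMGF d L i s ^ n) := by
      intro y _
      refine HasSum.mul_left _ ?_
      exact (Equiv.subRight y).hasSum_iff.2 ih
    have h := hasSum_sum hterm
    simp_rw [← hrepr] at h
    rw [pow_succ, mul_comm, soStepMGF, Finset.sum_mul]
    exact h

/-- **Chernoff bound for `D^{*n}`**: `e^{s x_i} D^{*n}(x) ≤ φ_i(s)ⁿ` for every `x` (one term of a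
series of nonnegative terms). [cite: HaraHofstadSlade2003, §6.4, proof of Lemma 6.4.2 ("φ_t(s) ≥ e^{s|x_1|} I_{t,1}(x)")] -/
theorem exp_mul_convPow_le (i : Fin d) (s : ℝ) (n : ℕ) (x : Site d) :
    Real.exp (s * ((x i : ℤ) : ℝ)) * convPow (soStep d L) n x ≤ soStepMGF d L i s ^ n :=
  le_hasSum (hasSum_exp_mul_convPow i s n) x fun y _ =>
    mul_nonneg (Real.exp_pos _).le (convPow_nonneg n y)

/-- **The exponential moment bound on the heat kernel** ((6.15) with (6.14)):
`e^{s x_i} I_{t,μ}(x) ≤ exp(-t + tμ φ_i(s))` for `μ, t ≥ 0`.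
[cite: HaraHofstadSlade2003, §6.4, proof of Lemma 6.4.2 ((6.14)–(6.15))] -/
theorem exp_mul_soHeat_le {μ t : ℝ} (hμ : 0 ≤ μ) (ht : 0 ≤ t) (i : Fin d) (s : ℝ) (x : Site d) :
    Real.exp (s * ((x i : ℤ) : ℝ)) * soHeat d L μ t x ≤ Real.exp (-t + t * μ * soStepMGF d L i s) := by
  have hφ := soStepMGF_nonneg (d := d) (L := L) i s
  have hsum := summable_soHeat_terms (d := d) (L := L) μ t x
  have hexp : HasSum (fun n : ℕ => (t * μ * soStepMGF d L i s) ^ n / (n.factorial : ℝ))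
      (Real.exp (t * μ * soStepMGF d L i s)) := by
    rw [Real.exp_eq_exp_ℝ]
    exact NormedSpace.expSeries_div_hasSum_exp _
  unfold soHeat
  rw [mul_left_comm, ← tsum_mul_left, Real.exp_add]
  refine mul_le_mul_of_nonneg_left ?_ (Real.exp_pos _).le
  rw [← hexp.tsum_eq]
  refine Summable.tsum_le_tsum (fun n => ?_) (hsum.mul_left _) hexp.summable
  calc Real.exp (s * ((x i : ℤ) : ℝ)) * ((t * μ) ^ n / (n.factorial : ℝ) * convPow (soStep d L) n x)
      = (t * μ) ^ n / (n.factorial : ℝ) * (Real.exp (s * ((x i : ℤ) : ℝ)) * convPow (soStep d L) n x) := by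
        ring
    _ ≤ (t * μ) ^ n / (n.factorial : ℝ) * soStepMGF d L i s ^ n :=
        mul_le_mul_of_nonneg_left (exp_mul_convPow_le i s n x) (by positivity)
    _ = (t * μ * soStepMGF d L i s) ^ n / (n.factorial : ℝ) := by rw [mul_pow]; ring

/-- `φ_i` is even: `φ_i(-s) = φ_i(s)` (reflect `y ↦ -y`, under which `D` and the neighbourhood
of the origin are invariant). [cite: HaraHofstadSlade2003, §6.4, proof of Lemma 6.4.2 ("using D(x) = D(-x)")] -/
theorem soStepMGF_neg (i : Fin d) (s : ℝ) : soStepMGF d L i (-s) = soStepMGF d L i s := by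
  unfold soStepMGF
  refine Finset.sum_nbij' (fun y => -y) (fun y => -y) ?_ ?_ (fun y _ => neg_neg y) (fun y _ => neg_neg y)
    (fun y _ => ?_)
  · intro y hy
    exact (neg_mem_neighborFinset_zero_iff y).2 hy
  · intro y hy
    exact (neg_mem_neighborFinset_zero_iff y).2 hy
  · rw [soStep_neg]
    congr 1
    simp only [Pi.neg_apply, Int.cast_neg]
    ring_nf

/-- **`φ_i(s) = Σ_y D(y) cosh(s y_i)`** ((6.14) in symmetrised form).
[cite: HaraHofstadSlade2003, §6.4 (6.14)] -/
theorem soStepMGF_eq_sum_cosh (i : Fin d) (s : ℝ) :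
    soStepMGF d L i s =
      ∑ y ∈ (spreadOutGraph d L).neighborFinset 0, soStep d L y * Real.cosh (s * ((y i : ℤ) : ℝ)) := by
  have h : soStepMGF d L i s = (soStepMGF d L i s + soStepMGF d L i (-s)) / 2 := by
    rw [soStepMGF_neg]; ring
  rw [h]
  unfold soStepMGF
  rw [← Finset.sum_add_distrib, Finset.sum_div]
  refine Finset.sum_congr rfl fun y _ => ?_
  rw [Real.cosh_eq, neg_mul]
  ring

/-- **`φ_i(s) - 1 ≤ s²σ²/d` for `|s| ≤ 1/L`** ((6.16)): on the support of `D`, `|s y_i| ≤ 1`, so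
`Σ_y D(y)(cosh(s y_i) - 1) ≤ s² Σ_y D(y) y_i² = s²σ²/d`.
[cite: HaraHofstadSlade2003, §6.4, proof of Lemma 6.4.2 ((6.16))] -/
theorem soStepMGF_sub_one_le (hd : 1 ≤ d) (hL : 1 ≤ L) (i : Fin d) {s : ℝ} (hs : |s| ≤ 1 / L) :
    soStepMGF d L i s - 1 ≤ s ^ 2 * (soVariance d L / d) := by
  have hL0 : (0 : ℝ) < L := by exact_mod_cast hL
  rw [soStepMGF_eq_sum_cosh, ← sum_soStep_eq_one hd hL, ← Finset.sum_sub_distrib, ← sum_soStep_mul_sq i,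
    Finset.mul_sum]
  refine Finset.sum_le_sum fun y hy => ?_
  have hyi := abs_apply_le_of_mem_neighborFinset hy i
  have hu : |s * ((y i : ℤ) : ℝ)| ≤ 1 := by
    rw [abs_mul]
    calc |s| * |((y i : ℤ) : ℝ)| ≤ 1 / L * L := mul_le_mul hs hyi (abs_nonneg _) (by positivity)
      _ = 1 := by field_simp
  have hc := Literature.MathematicalPhysics.QuantumLattice.cosh_sub_one_le_sq_of_abs_le_one hu
  have hD := soStep_nonneg (d := d) (L := L) y
  calc soStep d L y * Real.cosh (s * ((y i : ℤ) : ℝ)) - soStep d L y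
      = soStep d L y * (Real.cosh (s * ((y i : ℤ) : ℝ)) - 1) := by ring
    _ ≤ soStep d L y * (s * ((y i : ℤ) : ℝ)) ^ 2 := mul_le_mul_of_nonneg_left hc hD
    _ = s ^ 2 * (((y i : ℤ) : ℝ) ^ 2 * soStep d L y) := by ring

/-- **Lemma 6.4.2, master form** ((6.15)–(6.16)): for `d, L ≥ 1`, `0 ≤ μ ≤ 1`, `t ≥ 0`,
`0 ≤ s ≤ 1/L`, every `x` and every coordinate `i`,
`I_{t,μ}(x) ≤ exp(-s|x_i| + t s² σ²/d)`.
[cite: HaraHofstadSlade2003, Lemma 6.4.2 and its proof ((6.15)–(6.16))] -/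
theorem soHeat_le_exp_neg (hd : 1 ≤ d) (hL : 1 ≤ L) {μ t s : ℝ} (hμ : 0 ≤ μ) (hμ1 : μ ≤ 1)
    (ht : 0 ≤ t) (hs : 0 ≤ s) (hsL : s ≤ 1 / L) (x : Site d) (i : Fin d) :
    soHeat d L μ t x ≤ Real.exp (-(s * |((x i : ℤ) : ℝ)|) + t * s ^ 2 * (soVariance d L / d)) := by
  -- the signed parameter `s' = ± s` with `s' x_i = s |x_i|`
  set s' : ℝ := if 0 ≤ ((x i : ℤ) : ℝ) then s else -s with hs'def
  have hs'abs : |s'| ≤ 1 / L := by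
    rw [hs'def]; split_ifs
    · rwa [abs_of_nonneg hs]
    · rwa [abs_neg, abs_of_nonneg hs]
  have hs'x : s' * ((x i : ℤ) : ℝ) = s * |((x i : ℤ) : ℝ)| := by
    rw [hs'def]; split_ifs with h
    · rw [abs_of_nonneg h]
    · rw [abs_of_neg (lt_of_not_ge h)]; ring
  have hs'2 : s' ^ 2 = s ^ 2 := by
    rw [hs'def]; split_ifs
    · rfl
    · exact neg_sq s
  have hφ := soStepMGF_sub_one_le hd hL i hs'abs
  have hφ0 := soStepMGF_nonneg (d := d) (L := L) i s'
  have hmain := exp_mul_soHeat_le (d := d) (L := L) hμ ht i s' x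
  rw [hs'x] at hmain
  -- divide by `e^{s|x_i|}` and compare exponents
  have hE : 0 < Real.exp (s * |((x i : ℤ) : ℝ)|) := Real.exp_pos _
  have h1 : soHeat d L μ t x ≤
      Real.exp (-(s * |((x i : ℤ) : ℝ)|)) * Real.exp (-t + t * μ * soStepMGF d L i s') := by
    rw [Real.exp_neg, ← div_eq_inv_mul, le_div_iff₀ hE, mul_comm]
    exact hmain
  refine h1.trans ?_
  rw [← Real.exp_add]
  refine Real.exp_le_exp.2 ?_
  -- `-t + tμφ(s') ≤ t(φ(s') - 1) ≤ t s'² σ²/d = t s² σ²/d`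
  have hμφ : μ * soStepMGF d L i s' ≤ soStepMGF d L i s' := mul_le_of_le_one_left hφ0 hμ1
  have h2 : t * μ * soStepMGF d L i s' ≤ t * soStepMGF d L i s' := by
    rw [mul_assoc]; exact mul_le_mul_of_nonneg_left hμφ ht
  have h3 : t * (soStepMGF d L i s' - 1) ≤ t * (s' ^ 2 * (soVariance d L / d)) :=
    mul_le_mul_of_nonneg_left hφ ht
  rw [hs'2] at h3
  linarith

/-- **Lemma 6.4.2, first bound** ((6.12), `s = 1/L`): `I_{t,μ}(x) ≤ exp(-|x_i|/L + σ²t/(dL²))`.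
[cite: HaraHofstadSlade2003, Lemma 6.4.2 (6.12), first bound] -/
theorem soHeat_le_exp_neg_div (hd : 1 ≤ d) (hL : 1 ≤ L) {μ t : ℝ} (hμ : 0 ≤ μ) (hμ1 : μ ≤ 1)
    (ht : 0 ≤ t) (x : Site d) (i : Fin d) :
    soHeat d L μ t x ≤
      Real.exp (-(|((x i : ℤ) : ℝ)| / L) + soVariance d L * t / (d * (L : ℝ) ^ 2)) := by
  have hL0 : (0 : ℝ) < L := by exact_mod_cast hL
  have h := soHeat_le_exp_neg hd hL hμ hμ1 ht (s := 1 / L) (by positivity) le_rfl x i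
  refine h.trans (le_of_eq ?_)
  congr 1
  field_simp

/-- **Lemma 6.4.2, second bound** ((6.12), the optimal `s = d|x_i|/(2σ²t) ≤ 1/L`): for
`t ≥ t₀ = dL|x_i|/(2σ²)` (and `t > 0`), `I_{t,μ}(x) ≤ exp(-d x_i²/(4σ²t))`.
[cite: HaraHofstadSlade2003, Lemma 6.4.2 (6.12), second bound] -/
theorem soHeat_le_exp_neg_sq_div (hd : 1 ≤ d) (hL : 1 ≤ L) {μ t : ℝ} (hμ : 0 ≤ μ) (hμ1 : μ ≤ 1)
    (ht : 0 < t) (x : Site d) (i : Fin d)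
    (ht₀ : (d : ℝ) * L * |((x i : ℤ) : ℝ)| / (2 * soVariance d L) ≤ t) :
    soHeat d L μ t x ≤ Real.exp (-((d : ℝ) * ((x i : ℤ) : ℝ) ^ 2 / (4 * soVariance d L * t))) := by
  have hL0 : (0 : ℝ) < L := by exact_mod_cast hL
  have hd0 : (0 : ℝ) < d := by exact_mod_cast hd
  have hσ := soVariance_pos hd hL
  set a : ℝ := |((x i : ℤ) : ℝ)| with ha
  have ha0 : 0 ≤ a := abs_nonneg _
  set s : ℝ := (d : ℝ) * a / (2 * soVariance d L * t) with hsdef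
  have hs0 : 0 ≤ s := by positivity
  have hsL : s ≤ 1 / L := by
    rw [hsdef, div_le_div_iff₀ (by positivity) hL0, one_mul]
    calc (d : ℝ) * a * L = 2 * soVariance d L * ((d : ℝ) * L * a / (2 * soVariance d L)) := by
          field_simp
      _ ≤ 2 * soVariance d L * t := mul_le_mul_of_nonneg_left ht₀ (by positivity)
  have h := soHeat_le_exp_neg hd hL hμ hμ1 ht.le hs0 hsL x i
  refine h.trans (le_of_eq ?_)
  congr 1
  rw [← ha, hsdef, show ((x i : ℤ) : ℝ) ^ 2 = a ^ 2 by rw [ha, sq_abs]]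
  field_simp
  ring

/-! ## Part 3. Continuity in `t` and the small-time integral (Lemma 6.4.1) -/

/-- `t ↦ I_{t,μ}(x)` is continuous (a power series in `t` with coefficients in `[0, 1/n!]`,
times `e^{-t}`). [cite: HaraHofstadSlade2003, §6.4 (6.11)] -/
theorem continuous_soHeat (μ : ℝ) (x : Site d) : Continuous fun t : ℝ => soHeat d L μ t x := by
  have hg : Continuous fun t : ℝ => ∑' n : ℕ, (t * μ) ^ n / (n.factorial : ℝ) * convPow (soStep d L) n x := by
    refine continuous_iff_continuousAt.2 fun t₀ => ?_
    set R : ℝ := |t₀| + 1 with hR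
    have hcont : ContinuousOn
        (fun t : ℝ => ∑' n : ℕ, (t * μ) ^ n / (n.factorial : ℝ) * convPow (soStep d L) n x)
        (Set.Icc (-R) R) := by
      refine continuousOn_tsum (u := fun n : ℕ => (R * |μ|) ^ n / (n.factorial : ℝ))
        (fun n => ?_) (Real.summable_pow_div_factorial _) fun n t ht => ?_
      · exact (((continuous_id.mul continuous_const).pow n).div_const _).mul continuous_const
          |>.continuousOn
      · refine (abs_soHeat_term_le μ t n x).trans ?_
        refine div_le_div_of_nonneg_right (pow_le_pow_left₀ (abs_nonneg _) ?_ n) (Nat.cast_nonneg _)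
        rw [abs_mul]
        refine mul_le_mul_of_nonneg_right (abs_le.2 ⟨ht.1, ht.2⟩) (abs_nonneg _)
    refine hcont.continuousAt (Icc_mem_nhds ?_ ?_)
    · rw [hR]; linarith [neg_abs_le t₀]
    · rw [hR]; linarith [le_abs_self t₀]
  exact (Real.continuous_exp.comp continuous_neg).mul hg

/-- `t ↦ I_{t,μ}(x)` is integrable on bounded time intervals. [folklore] -/
theorem integrableOn_soHeat_Ioc (μ : ℝ) (x : Site d) (a b : ℝ) :
    IntegrableOn (fun t : ℝ => soHeat d L μ t x) (Set.Ioc a b) :=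
  ((continuous_soHeat μ x).continuousOn.integrableOn_compact isCompact_Icc).mono_set
    Set.Ioc_subset_Icc_self

/-- **Pointwise small-time bound**: for `0 < t ≤ T`,
`I_{t,μ}(x) ≤ e^{-|x_i|/(2L)} + e^{-d x_i²/(4σ²T)}` — the first large-deviation bound for
`t ≤ t₀ = dL|x_i|/(2σ²)` (where `σ²t/(dL²) ≤ |x_i|/(2L)`), the second for `t ≥ t₀` (and
`e^{-c/t} ≤ e^{-c/T}`). [cite: HaraHofstadSlade2003, proof of Lemma 6.4.1 (the two regimes t < t₀, t ≥ t₀)] -/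
theorem soHeat_le_smallTime_bound (hd : 1 ≤ d) (hL : 1 ≤ L) {μ : ℝ} (hμ : 0 ≤ μ) (hμ1 : μ ≤ 1)
    (x : Site d) (i : Fin d) {T t : ℝ} (ht : 0 < t) (htT : t ≤ T) :
    soHeat d L μ t x ≤ Real.exp (-(|((x i : ℤ) : ℝ)| / (2 * L))) +
      Real.exp (-((d : ℝ) * ((x i : ℤ) : ℝ) ^ 2 / (4 * soVariance d L * T))) := by
  have hL0 : (0 : ℝ) < L := by exact_mod_cast hL
  have hd0 : (0 : ℝ) < d := by exact_mod_cast hd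
  have hσ := soVariance_pos hd hL
  have hT : 0 < T := lt_of_lt_of_le ht htT
  set a : ℝ := |((x i : ℤ) : ℝ)| with ha
  have ha0 : 0 ≤ a := abs_nonneg _
  have hE1 := Real.exp_pos (-(a / (2 * L)))
  have hE2 := Real.exp_pos (-((d : ℝ) * ((x i : ℤ) : ℝ) ^ 2 / (4 * soVariance d L * T)))
  rcases le_or_gt t ((d : ℝ) * L * a / (2 * soVariance d L)) with h₀ | h₀
  · -- small `t`: the first bound
    have h := soHeat_le_exp_neg_div hd hL hμ hμ1 ht.le x i
    refine (h.trans ?_).trans (le_add_of_nonneg_right hE2.le)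
    refine Real.exp_le_exp.2 ?_
    rw [← ha]
    have h1 : soVariance d L * t / ((d : ℝ) * (L : ℝ) ^ 2) ≤ a / (2 * L) := by
      rw [div_le_div_iff₀ (by positivity) (by positivity)]
      calc soVariance d L * t * (2 * L) ≤ soVariance d L * ((d : ℝ) * L * a / (2 * soVariance d L)) * (2 * L) := by
            gcongr
        _ = a * ((d : ℝ) * (L : ℝ) ^ 2) := by field_simp
    have h2 : -(a / L) + a / (2 * L) = -(a / (2 * L)) := by field_simp; ring
    linarith
  · -- large `t`: the second bound, then monotonicity in `t ≤ T`
    have h := soHeat_le_exp_neg_sq_div hd hL hμ hμ1 ht x i h₀.le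
    refine (h.trans ?_).trans (le_add_of_nonneg_left hE1.le)
    refine Real.exp_le_exp.2 (neg_le_neg ?_)
    exact div_le_div_of_nonneg_left (by positivity) (by positivity)
      (mul_le_mul_of_nonneg_left htT (by positivity))

/-- **Lemma 6.4.1 (small-time integral)** in the form used downstream: for `d, L ≥ 1`,
`0 ≤ μ ≤ 1`, `T > 0`, every `x` and every coordinate `i`,
`S^<_μ(x;T) = ∫₀ᵀ I_{t,μ}(x) dt ≤ T (e^{-|x_i|/(2L)} + e^{-d x_i²/(4σ²T)})`. (The source states
`S^<_μ(x;T) ≤ (|x|+1)^{-(d+2)}` for `|x| ≥ L^{1+α/d}`, `T ≤ T_x`, `L ≫ 1`; this explicit bound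
is what its proof gives before the final comparison of exponentials with powers.)
[cite: HaraHofstadSlade2003, Lemma 6.4.1 (6.10) and its proof] -/
theorem integral_soHeat_Ioc_le (hd : 1 ≤ d) (hL : 1 ≤ L) {μ : ℝ} (hμ : 0 ≤ μ) (hμ1 : μ ≤ 1)
    (x : Site d) (i : Fin d) {T : ℝ} (hT : 0 < T) :
    ∫ t in Set.Ioc 0 T, soHeat d L μ t x ≤
      T * (Real.exp (-(|((x i : ℤ) : ℝ)| / (2 * L))) +
        Real.exp (-((d : ℝ) * ((x i : ℤ) : ℝ) ^ 2 / (4 * soVariance d L * T)))) := by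
  set B : ℝ := Real.exp (-(|((x i : ℤ) : ℝ)| / (2 * L))) +
    Real.exp (-((d : ℝ) * ((x i : ℤ) : ℝ) ^ 2 / (4 * soVariance d L * T))) with hB
  have hpt : ∀ t ∈ Set.Ioc (0 : ℝ) T, soHeat d L μ t x ≤ B := fun t ht =>
    soHeat_le_smallTime_bound hd hL hμ hμ1 x i ht.1 ht.2
  calc ∫ t in Set.Ioc 0 T, soHeat d L μ t x ≤ ∫ t in Set.Ioc 0 T, B :=
        setIntegral_mono_on (integrableOn_soHeat_Ioc μ x 0 T) (integrableOn_const (by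
          rw [Real.volume_Ioc]; exact ENNReal.ofReal_ne_top)) measurableSet_Ioc hpt
    _ = T * B := by
        rw [setIntegral_const, Real.volume_real_Ioc_of_le hT.le, sub_zero, smul_eq_mul]

/-! ## Part 4. The time integral: `∫₀^∞ I_{t,μ}(x) dt = S_μ(x)` -/

/-- `∫₀^∞ e^{-t} tⁿ/n! dt = 1`. [folklore] -/
theorem integral_exp_neg_mul_pow_div_factorial (n : ℕ) :
    ∫ t in Set.Ioi (0 : ℝ), Real.exp (-t) * (t ^ n / (n.factorial : ℝ)) = 1 := by
  have h := Real.integral_rpow_mul_exp_neg_mul_Ioi (a := (n : ℝ) + 1) (r := 1) (by positivity) one_pos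
  rw [add_sub_cancel_right, one_div_one, Real.one_rpow, one_mul, Real.Gamma_nat_eq_factorial] at h
  have hn : (n.factorial : ℝ) ≠ 0 := by positivity
  have h' : ∫ t in Set.Ioi (0 : ℝ), Real.exp (-t) * (t ^ n / (n.factorial : ℝ)) =
      (∫ t in Set.Ioi (0 : ℝ), t ^ (n : ℝ) * Real.exp (-(1 * t))) / (n.factorial : ℝ) := by
    rw [← integral_div]
    refine setIntegral_congr_fun measurableSet_Ioi fun t ht => ?_
    rw [Real.rpow_natCast, one_mul]
    ring
  rw [h', h, div_self hn]

/-- The `n`-th term of the heat kernel integrates to the `n`-th term of the Green function: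
`∫₀^∞ e^{-t}(tμ)ⁿ/n! D^{*n}(x) dt = μⁿ D^{*n}(x)`, and the integrand is integrable on `(0,∞)`.
[cite: HaraHofstadSlade2003, §6.2 (6.9) with §6.4 (6.11)] -/
theorem integral_soHeat_term (μ : ℝ) (n : ℕ) (x : Site d) :
    IntegrableOn (fun t : ℝ => Real.exp (-t) * ((t * μ) ^ n / (n.factorial : ℝ) * convPow (soStep d L) n x))
        (Set.Ioi 0) ∧
      ∫ t in Set.Ioi (0 : ℝ), Real.exp (-t) * ((t * μ) ^ n / (n.factorial : ℝ) * convPow (soStep d L) n x) =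
        μ ^ n * convPow (soStep d L) n x := by
  -- the integrand is `c · (e^{-t} tⁿ/n!)` with `c = μⁿ D^{*n}(x)`
  set c : ℝ := μ ^ n * convPow (soStep d L) n x with hc
  have hfun : (fun t : ℝ => Real.exp (-t) * ((t * μ) ^ n / (n.factorial : ℝ) * convPow (soStep d L) n x)) =
      fun t => c * (Real.exp (-t) * (t ^ n / (n.factorial : ℝ))) := by
    funext t; rw [hc, mul_pow]; ring
  rw [hfun]
  have hint : IntegrableOn (fun t : ℝ => Real.exp (-t) * (t ^ n / (n.factorial : ℝ))) (Set.Ioi 0) := by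
    have h : IntegrableOn (fun t : ℝ => Real.exp (-t) * t ^ ((n : ℝ) + 1 - 1) / (n.factorial : ℝ))
        (Set.Ioi 0) :=
      (Real.GammaIntegral_convergent (s := (n : ℝ) + 1) (by positivity)).div_const (n.factorial : ℝ)
    refine h.congr_fun (fun t ht => ?_) measurableSet_Ioi
    dsimp only
    rw [add_sub_cancel_right, Real.rpow_natCast]
    ring
  refine ⟨hint.const_mul c, ?_⟩
  rw [integral_const_mul, integral_exp_neg_mul_pow_div_factorial, mul_one]

/-- **The integral representation `S_μ(x) = ∫₀^∞ I_{t,μ}(x) dt`** ((6.9)) for `0 ≤ μ ≤ 1`, `d ≥ 3`,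
`L ≥ 1`, together with the integrability of `t ↦ I_{t,μ}(x)` on `(0, ∞)`: term by term from
`∫₀^∞ e^{-t}(tμ)ⁿ/n! dt = μⁿ` (monotone convergence, all terms being nonnegative; the source
derives (6.9) from the Fourier representation and `1/A = ∫₀^∞ e^{-tA}dt`).
[cite: HaraHofstadSlade2003, §6.2 (6.8)–(6.9)] -/
theorem integral_soHeat_eq_soGreen (hd : 3 ≤ d) (hL : 1 ≤ L) {μ : ℝ} (hμ : 0 ≤ μ) (hμ1 : μ ≤ 1)
    (x : Site d) :
    IntegrableOn (fun t : ℝ => soHeat d L μ t x) (Set.Ioi 0) ∧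
      ∫ t in Set.Ioi (0 : ℝ), soHeat d L μ t x = soGreen d L μ x := by
  set F : ℕ → ℝ → ℝ := fun n t =>
    Real.exp (-t) * ((t * μ) ^ n / (n.factorial : ℝ) * convPow (soStep d L) n x) with hF
  have hF_int : ∀ n, Integrable (F n) (volume.restrict (Set.Ioi (0 : ℝ))) := fun n =>
    (integral_soHeat_term μ n x).1
  have hF_val : ∀ n, ∫ t in Set.Ioi (0 : ℝ), F n t = μ ^ n * convPow (soStep d L) n x := fun n =>
    (integral_soHeat_term μ n x).2
  have hF_nonneg : ∀ n, ∀ t ∈ Set.Ioi (0 : ℝ), 0 ≤ F n t := fun n t ht =>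
    mul_nonneg (Real.exp_pos _).le (mul_nonneg (div_nonneg (pow_nonneg (mul_nonneg (le_of_lt ht) hμ) n)
      (Nat.cast_nonneg _)) (convPow_nonneg n x))
  have hF_norm : ∀ n, ∫ t in Set.Ioi (0 : ℝ), ‖F n t‖ = μ ^ n * convPow (soStep d L) n x := by
    intro n
    rw [← hF_val n]
    refine setIntegral_congr_fun measurableSet_Ioi fun t ht => ?_
    rw [Real.norm_eq_abs, abs_of_nonneg (hF_nonneg n t ht)]
  have hsum : Summable fun n => ∫ t in Set.Ioi (0 : ℝ), ‖F n t‖ := by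
    simp_rw [hF_norm]; exact summable_soGreen_terms_of_le_one hd hL hμ hμ1 x
  -- `soHeat = Σ_n F n` pointwise
  have hheat : ∀ t : ℝ, soHeat d L μ t x = ∑' n, F n t := fun t => by
    simp only [hF, soHeat]; rw [tsum_mul_left]
  have heq : ∫ t in Set.Ioi (0 : ℝ), soHeat d L μ t x = soGreen d L μ x := by
    simp_rw [hheat]
    rw [← integral_tsum_of_summable_integral_norm hF_int hsum]
    simp_rw [hF_val]
    rfl
  refine ⟨?_, heq⟩
  -- integrability: nonnegative with finite lower integral `= S_μ(x)`
  have hmeas : AEStronglyMeasurable (fun t : ℝ => soHeat d L μ t x) (volume.restrict (Set.Ioi 0)) :=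
    (continuous_soHeat μ x).aestronglyMeasurable
  have hnn : 0 ≤ᵐ[volume.restrict (Set.Ioi (0 : ℝ))] fun t => soHeat d L μ t x := by
    filter_upwards [ae_restrict_mem measurableSet_Ioi] with t ht
    exact soHeat_nonneg hμ (le_of_lt ht) x
  refine ⟨hmeas, (hasFiniteIntegral_iff_ofReal hnn).2 ?_⟩
  have hsumF : ∀ t ∈ Set.Ioi (0 : ℝ), Summable fun n => F n t := fun t _ => by
    simp only [hF]; exact (summable_soHeat_terms μ t x).mul_left _
  have hlin : ∫⁻ t in Set.Ioi (0 : ℝ), ENNReal.ofReal (soHeat d L μ t x) =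
      ∑' n, ∫⁻ t in Set.Ioi (0 : ℝ), ENNReal.ofReal (F n t) := by
    rw [← lintegral_tsum fun n => ((hF_int n).1.aemeasurable.ennreal_ofReal)]
    refine setLIntegral_congr_fun measurableSet_Ioi fun t ht => ?_
    rw [hheat t, ENNReal.ofReal_tsum_of_nonneg (fun n => hF_nonneg n t ht) (hsumF t ht)]
  have hterm : ∀ n, ∫⁻ t in Set.Ioi (0 : ℝ), ENNReal.ofReal (F n t) =
      ENNReal.ofReal (μ ^ n * convPow (soStep d L) n x) := fun n => by
    rw [← hF_val n, ofReal_integral_eq_lintegral_ofReal (hF_int n)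
      ((ae_restrict_mem measurableSet_Ioi).mono fun t ht => hF_nonneg n t ht)]
  rw [hlin]
  simp_rw [hterm]
  rw [← ENNReal.ofReal_tsum_of_nonneg (fun n => mul_nonneg (pow_nonneg hμ n) (convPow_nonneg n x))
    (summable_soGreen_terms_of_le_one hd hL hμ hμ1 x)]
  exact ENNReal.ofReal_lt_top

/-! ## Part 5. The Fourier representation of the heat kernel -/

/-- **The Fourier representation (6.8) of the heat kernel**:
`I_{t,μ}(x) = (2π)^{-d} ∫_{[-π,π]^d} cos(k·x) e^{-t[1 - μD̂(k)]} dk` — the source's definition of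
`I_{t,μ}`, here derived from the series (6.11) by integrating the exponential series term by term
against the Fourier representation `D^{*n}(x) = (2π)^{-d}∫ D̂ⁿ cos(k·x)` (`convPow_eq_integral`).
[cite: HaraHofstadSlade2003, §6.2 (6.8) and §6.4 (6.11) ("expanding the exponential … and interchanging the integral and the sum")] -/
theorem soHeat_eq_integral (μ t : ℝ) (x : Site d) :
    soHeat d L μ t x = ((2 * Real.pi) ^ d)⁻¹ *
      ∫ k in cube d, Real.cos (kdot k x) * Real.exp (-(t * (1 - μ * soSymbol d L k))) := by
  set F : ℕ → (Fin d → ℝ) → ℝ := fun n k =>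
    (t * μ) ^ n / (n.factorial : ℝ) * (soSymbol d L k ^ n * Real.cos (kdot k x)) with hF
  have hF_int : ∀ n, Integrable (F n) (volume.restrict (cube d)) := fun n =>
    (integrableOn_soSymbol_pow_mul_cos n x).const_mul _
  have hF_bound : ∀ n k, ‖F n k‖ ≤ |t * μ| ^ n / (n.factorial : ℝ) := by
    intro n k
    rw [Real.norm_eq_abs, hF]
    dsimp only
    rw [abs_mul, abs_div, abs_pow, Nat.abs_cast]
    refine mul_le_of_le_one_right (by positivity) ?_
    rw [abs_mul, abs_pow]
    exact mul_le_one₀ (pow_le_one₀ (abs_nonneg _) (abs_soSymbol_le_one k)) (abs_nonneg _)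
      (Real.abs_cos_le_one _)
  have hvol : volume (cube d) ≠ ⊤ := (volume_cube_lt_top d).ne
  have hF_norm_le : ∀ n, ∫ k in cube d, ‖F n k‖ ≤ (volume (cube d)).toReal * (|t * μ| ^ n / (n.factorial : ℝ)) := by
    intro n
    calc ∫ k in cube d, ‖F n k‖ ≤ ∫ _ in cube d, |t * μ| ^ n / (n.factorial : ℝ) :=
          setIntegral_mono_on (hF_int n).norm (integrableOn_const hvol) (measurableSet_cube d)
            fun k _ => hF_bound n k
      _ = (volume (cube d)).toReal * (|t * μ| ^ n / (n.factorial : ℝ)) := by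
          rw [setIntegral_const, smul_eq_mul]; rfl
  have hF_sum : Summable fun n => ∫ k in cube d, ‖F n k‖ := by
    refine Summable.of_nonneg_of_le (fun n => integral_nonneg fun k => norm_nonneg _) hF_norm_le ?_
    exact (Real.summable_pow_div_factorial _).mul_left _
  -- the series, term by term
  have hseries : ∑' n : ℕ, (t * μ) ^ n / (n.factorial : ℝ) * convPow (soStep d L) n x =
      ((2 * Real.pi) ^ d)⁻¹ * ∫ k in cube d, Real.exp (t * μ * soSymbol d L k) * Real.cos (kdot k x) := by
    have h1 : ∀ n : ℕ, (t * μ) ^ n / (n.factorial : ℝ) * convPow (soStep d L) n x =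
        ((2 * Real.pi) ^ d)⁻¹ * ∫ k in cube d, F n k := by
      intro n
      rw [convPow_eq_integral, hF]
      dsimp only
      rw [integral_const_mul]
      ring
    simp_rw [h1]
    rw [tsum_mul_left, integral_tsum_of_summable_integral_norm hF_int hF_sum]
    congr 1
    refine integral_congr_ae (ae_of_all _ fun k => ?_)
    have hexp : HasSum (fun n : ℕ => (t * μ * soSymbol d L k) ^ n / (n.factorial : ℝ))
        (Real.exp (t * μ * soSymbol d L k)) := by
      rw [Real.exp_eq_exp_ℝ]
      exact NormedSpace.expSeries_div_hasSum_exp _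
    have h2 : ∀ n, F n k = (t * μ * soSymbol d L k) ^ n / (n.factorial : ℝ) * Real.cos (kdot k x) := by
      intro n; rw [hF]; dsimp only; rw [mul_pow]; ring
    simp_rw [h2]
    exact (hexp.mul_right _).tsum_eq
  unfold soHeat
  rw [hseries, ← mul_assoc, mul_comm (Real.exp (-t)), mul_assoc, ← integral_const_mul]
  congr 1
  refine integral_congr_ae (ae_of_all _ fun k => ?_)
  dsimp only
  rw [← mul_assoc, ← Real.exp_add, mul_comm]
  congr 1
  ring_nf

/-- The kernel `μD` is absolutely summable and even. [folklore] -/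
theorem summable_abs_mul_soStep (μ : ℝ) : Summable fun y : Site d => |μ * soStep d L y| := by
  simpa only [abs_mul] using (summable_abs_soStep (d := d) (L := L)).mul_left |μ|

/-- The symbol of `μD` is real: `Re (μD)^(k) = μ D̂(k)`. [folklore] -/
theorem re_latticeFT_mul_soStep (μ : ℝ) (k : Fin d → ℝ) :
    (latticeFT (fun y => μ * soStep d L y) k).re = μ * soSymbol d L k := by
  rw [latticeFT_const_mul, Complex.re_ofReal_mul, soSymbol_eq_re_latticeFT]

/-- **The heat kernel is Hara's `I_t` for the kernel `J = μD`**: `Re I_t[μD](x) = I_{t,μ}(x)`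
(Hara 2008, (2.2): `I_t(x) = ∫ e^{ik·x}e^{-t(1-Ĵ(k))} dk/(2π)^d`; for `μ = 1` this makes Hara's
large-`t` Lemma 2.2, proved in the tree, available for the spread-out walk).
[cite: HaraHofstadSlade2003, §6.2 (6.8)] [cite: Hara2008, §2.1 (2.2)] -/
theorem re_haraI_mul_soStep (μ t : ℝ) (x : Site d) :
    (haraI (fun y => μ * soStep d L y) t x).re = soHeat d L μ t x := by
  have hJ := summable_abs_mul_soStep (d := d) (L := L) μ
  have hJe : ∀ y : Site d, μ * soStep d L (-y) = μ * soStep d L y := fun y => by rw [soStep_neg]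
  have h := two_pi_pow_mul_haraI hJ hJe t x
  have h2π : ((2 * Real.pi : ℂ)) ^ d = (((2 * Real.pi) ^ d : ℝ) : ℂ) := by push_cast; ring
  have hπ0 : ((2 * Real.pi) ^ d : ℝ) ≠ 0 := by positivity
  -- real part of the integral
  have hint : Integrable (fun k => Complex.exp (Complex.I * (kdot k x : ℂ)) *
      (Real.exp (-(t * (1 - (latticeFT (fun y => μ * soStep d L y) k).re))) : ℂ)) (volume.restrict (cube d)) := by
    refine ContinuousOn.integrableOn_compact (isCompact_univ_pi fun _ => isCompact_Icc) ?_
    refine ((Complex.continuous_exp.comp (continuous_const.mul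
      (Complex.continuous_ofReal.comp (continuous_kdot_left x)))).mul
        (Complex.continuous_ofReal.comp (Real.continuous_exp.comp ?_))).continuousOn
    simp_rw [re_latticeFT_mul_soStep]
    exact (continuous_const.mul (continuous_const.sub (continuous_const.mul continuous_soSymbol))).neg
  have hre : (∫ k in cube d, Complex.exp (Complex.I * (kdot k x : ℂ)) *
      (Real.exp (-(t * (1 - (latticeFT (fun y => μ * soStep d L y) k).re))) : ℂ)).re =
      ∫ k in cube d, Real.cos (kdot k x) * Real.exp (-(t * (1 - μ * soSymbol d L k))) := by
    rw [← RCLike.re_to_complex, ← integral_re hint]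
    refine integral_congr_ae (ae_of_all _ fun k => ?_)
    simp only [RCLike.re_to_complex, Complex.re_mul_ofReal, re_latticeFT_mul_soStep]
    rw [mul_comm Complex.I, Complex.exp_ofReal_mul_I_re]
  have hI : haraI (fun y => μ * soStep d L y) t x =
      (∫ k in cube d, Complex.exp (Complex.I * (kdot k x : ℂ)) *
        (Real.exp (-(t * (1 - (latticeFT (fun y => μ * soStep d L y) k).re))) : ℂ)) / (((2 * Real.pi) ^ d : ℝ) : ℂ) := by
    rw [← h, h2π, mul_div_cancel_left₀ _ (by exact_mod_cast hπ0)]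
  rw [hI, Complex.div_ofReal_re, hre, soHeat_eq_integral, div_eq_inv_mul]

/-- In particular `Re I_t[D](x) = I_{t,1}(x)` for Sakai's step distribution itself. [cite: Hara2008, §2.1 (2.2)] -/
theorem re_haraI_soStep (t : ℝ) (x : Site d) : (haraI (soStep d L) t x).re = soHeat d L 1 t x := by
  have h := re_haraI_mul_soStep (d := d) (L := L) 1 t x
  simp only [one_mul] at h
  exact h


/-! ## Part 6. The sharp Gaussian asymptotics of `S_1` at fixed `L` (§6.5) -/

/-! ### Elementary helpers -/

/-- `r^p e^{-c r^δ}` is bounded on `r > 0` (`c, δ, p > 0`): with `s = c r^δ`,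
`r^p e^{-cr^δ} = c^{-p/δ} s^{p/δ} e^{-s} ≤ c^{-p/δ}((p/δ)/e)^{p/δ}`.
[cite: HaraHofstadSlade2003, §6.4 ("decays at least as fast as … an exponential of a power of |x|, and hence eventually decays faster than |x|^{-(d+2)}")] -/
theorem exists_rpow_mul_exp_neg_rpow_le {c δ p : ℝ} (hc : 0 < c) (hδ : 0 < δ) (hp : 0 < p) :
    ∃ C : ℝ, 0 < C ∧ ∀ r : ℝ, 0 < r → r ^ p * Real.exp (-(c * r ^ δ)) ≤ C := by
  refine ⟨c ^ (-(p / δ)) * (p / δ / Real.exp 1) ^ (p / δ), by positivity, fun r hr => ?_⟩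
  set s : ℝ := c * r ^ δ with hs
  have hs0 : 0 < s := by positivity
  have hkey := rpow_mul_exp_neg_le hs0 (div_pos hp hδ)
  have hr : r ^ p = c ^ (-(p / δ)) * s ^ (p / δ) := by
    rw [hs, Real.mul_rpow hc.le (Real.rpow_nonneg hr.le _), ← Real.rpow_mul hr.le,
      show δ * (p / δ) = p by field_simp, ← mul_assoc, ← Real.rpow_add hc,
      show -(p / δ) + p / δ = 0 by ring, Real.rpow_zero, one_mul]
  rw [hr, mul_assoc]
  exact mul_le_mul_of_nonneg_left hkey (Real.rpow_nonneg hc.le _)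

/-- Some coordinate carries a `1/√d` fraction of the Euclidean norm: `|x|² ≤ d · x_i²` for the
coordinate `i` maximising `|x_i|` (`d ≥ 1`). [folklore] -/
theorem exists_sq_euclidNorm_le (hd : 1 ≤ d) (x : Site d) :
    ∃ i : Fin d, euclidNorm x ^ 2 ≤ d * ((x i : ℤ) : ℝ) ^ 2 := by
  haveI : Nonempty (Fin d) := ⟨⟨0, hd⟩⟩
  obtain ⟨i, -, hi⟩ := Finset.exists_max_image Finset.univ (fun j : Fin d => |((x j : ℤ) : ℝ)|)
    Finset.univ_nonempty
  refine ⟨i, ?_⟩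
  rw [euclidNorm_sq]
  calc ∑ j, ((x j : ℤ) : ℝ) ^ 2 ≤ ∑ _j : Fin d, ((x i : ℤ) : ℝ) ^ 2 :=
        Finset.sum_le_sum fun j _ => by
          rw [← sq_abs, ← sq_abs ((x i : ℤ) : ℝ)]
          exact pow_le_pow_left₀ (abs_nonneg _) (hi j (Finset.mem_univ j)) 2
    _ = d * ((x i : ℤ) : ℝ) ^ 2 := by simp

/-- **From a bound beyond a radius to a bound at all `x ≠ 0`**: finitely many lattice points lie
below the radius, and a positive majorant absorbs them into the constant. [folklore] -/
theorem exists_forall_ne_zero_of_forall_le_norm {f g : Site d → ℝ} (hg : ∀ x, x ≠ 0 → 0 < g x)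
    {K R : ℝ} (h : ∀ x : Site d, R ≤ euclidNorm x → |f x| ≤ K * g x) :
    ∃ K' : ℝ, ∀ x : Site d, x ≠ 0 → |f x| ≤ K' * g x := by
  have hfin : {x : Site d | ¬R ≤ euclidNorm x}.Finite :=
    Filter.eventually_cofinite.1 ((tendsto_euclidNorm_cofinite d).eventually_ge_atTop R)
  set S : Finset (Site d) := hfin.toFinset.filter (· ≠ 0) with hS
  set K' : ℝ := max K (∑ y ∈ S, |f y| / g y) with hK'
  refine ⟨K', fun x hx => ?_⟩
  by_cases hR : R ≤ euclidNorm x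
  · exact (h x hR).trans (mul_le_mul_of_nonneg_right (le_max_left _ _) (hg x hx).le)
  · have hxS : x ∈ S := by
      rw [hS, Finset.mem_filter, Set.Finite.mem_toFinset]
      exact ⟨hR, hx⟩
    have hgx := hg x hx
    have hsum : |f x| / g x ≤ ∑ y ∈ S, |f y| / g y :=
      Finset.single_le_sum (f := fun y => |f y| / g y) (fun y hy => by
        have hy0 : y ≠ 0 := (Finset.mem_filter.1 hy).2
        exact div_nonneg (abs_nonneg _) (hg y hy0).le) hxS
    calc |f x| = |f x| / g x * g x := by field_simp
      _ ≤ K' * g x := mul_le_mul_of_nonneg_right (hsum.trans (le_max_right _ _)) hgx.le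

/-- **Monotonicity of the Gaussian main term in time before its maximum**: for
`0 < t₁ ≤ t₂ ≤ r²/K₁`, `p_{t₁}(r) ≤ p_{t₂}(r)` (`t ↦ t^{-d/2}e^{-dr²/(2K₁t)}` increases up to
`t = r²/K₁`; from `log(t₂/t₁) ≤ t₂/t₁ - 1`). This replaces the source's integral inequality
(6.19) in bounding `∫₀ᵀ p_t dt ≤ T p_T`. [cite: HaraHofstadSlade2003, §6.5 (6.18)–(6.19)] -/
theorem gaussMain_mono_of_le (hd : 1 ≤ d) {K₁ r t₁ t₂ : ℝ} (hK : 0 < K₁) (hr : 0 < r)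
    (ht₁ : 0 < t₁) (h12 : t₁ ≤ t₂) (ht₂ : t₂ ≤ r ^ 2 / K₁) :
    gaussMain d K₁ t₁ r ≤ gaussMain d K₁ t₂ r := by
  have hd0 : (0 : ℝ) < d := by exact_mod_cast hd
  have ht₂0 : 0 < t₂ := lt_of_lt_of_le ht₁ h12
  set β : ℝ := (d : ℝ) / 2 with hβ
  set a : ℝ := (d : ℝ) * r ^ 2 / (2 * K₁) with ha
  have hβ0 : 0 < β := by positivity
  have haβ : a = β * (r ^ 2 / K₁) := by rw [ha, hβ]; field_simp
  rw [gaussMain_eq d hK ht₁ r, gaussMain_eq d hK ht₂0 r]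
  refine mul_le_mul_of_nonneg_left ?_ (Real.rpow_nonneg (by positivity) _)
  -- compare logarithms: `-β log t₁ - a/t₁ ≤ -β log t₂ - a/t₂`
  rw [show (d : ℝ) * r ^ 2 / (2 * K₁) = a from rfl, show (d : ℝ) / 2 = β from rfl,
    Real.rpow_def_of_pos ht₁, Real.rpow_def_of_pos ht₂0, ← Real.exp_add, ← Real.exp_add]
  refine Real.exp_le_exp.2 ?_
  have hlog : Real.log t₂ - Real.log t₁ ≤ (t₂ - t₁) / t₁ := by
    calc Real.log t₂ - Real.log t₁ = Real.log (t₂ / t₁) := (Real.log_div ht₂0.ne' ht₁.ne').symm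
      _ ≤ t₂ / t₁ - 1 := Real.log_le_sub_one_of_pos (div_pos ht₂0 ht₁)
      _ = (t₂ - t₁) / t₁ := by field_simp
  -- `β (t₂ - t₁)/t₁ ≤ a (t₂ - t₁)/(t₁ t₂)` since `β t₂ ≤ a`
  have hβa : β ≤ a / t₂ := by
    rw [le_div_iff₀ ht₂0, haβ]; exact mul_le_mul_of_nonneg_left ht₂ hβ0.le
  have hdiff : a / t₁ - a / t₂ = a / t₂ * ((t₂ - t₁) / t₁) := by field_simp
  have h1 : β * (Real.log t₂ - Real.log t₁) ≤ β * ((t₂ - t₁) / t₁) := mul_le_mul_of_nonneg_left hlog hβ0.le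
  have h2 : β * ((t₂ - t₁) / t₁) ≤ a / t₂ * ((t₂ - t₁) / t₁) :=
    mul_le_mul_of_nonneg_right hβa (div_nonneg (by linarith) ht₁.le)
  have h3 : Real.log t₁ * -β + -(a / t₁) ≤ Real.log t₂ * -β + -(a / t₂) ↔
      β * (Real.log t₂ - Real.log t₁) ≤ a / t₁ - a / t₂ := by
    constructor <;> intro h <;> linarith
  rw [h3, hdiff]
  exact h1.trans h2

/-! ### The small-time piece in Euclidean terms -/

/-- **Small times (Lemma 6.4.1 applied with `‖x‖_∞ ≥ |x|/√d`)**: for `|x| ≥ 1`, `T > 0` and the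
coordinate `i` of `exists_sq_euclidNorm_le`,
`∫₀ᵀ I_{t,1}(x) dt ≤ T (e^{-|x|/(2L√d)·…} + …) ≤ 2T e^{-c₀ min(|x|, |x|²/T)}`; stated in the raw
two-exponential form with `|x_i| ≥ |x|/√d` substituted. [cite: HaraHofstadSlade2003, Lemma 6.4.1 and §6.5] -/
theorem integral_soHeat_Ioc_le_euclid (hd : 1 ≤ d) (hL : 1 ≤ L) {μ : ℝ} (hμ : 0 ≤ μ) (hμ1 : μ ≤ 1)
    (x : Site d) {T : ℝ} (hT : 0 < T) :
    ∫ t in Set.Ioc 0 T, soHeat d L μ t x ≤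
      T * (Real.exp (-(euclidNorm x / (2 * L * Real.sqrt d))) +
        Real.exp (-(euclidNorm x ^ 2 / (4 * soVariance d L * T)))) := by
  have hd0 : (0 : ℝ) < d := by exact_mod_cast hd
  have hL0 : (0 : ℝ) < L := by exact_mod_cast hL
  have hσ := soVariance_pos hd hL
  obtain ⟨i, hi⟩ := exists_sq_euclidNorm_le hd x
  have h := integral_soHeat_Ioc_le hd hL hμ hμ1 x i hT
  refine h.trans (mul_le_mul_of_nonneg_left (add_le_add ?_ ?_) hT.le)
  · refine Real.exp_le_exp.2 (neg_le_neg ?_)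
    -- `|x|/(2L√d) ≤ |x_i|/(2L)` from `|x| ≤ √d |x_i|`
    have hsd : 0 < Real.sqrt d := Real.sqrt_pos.2 hd0
    have hxi : euclidNorm x ≤ Real.sqrt d * |((x i : ℤ) : ℝ)| := by
      have h1 : euclidNorm x ^ 2 ≤ (Real.sqrt d * |((x i : ℤ) : ℝ)|) ^ 2 := by
        rw [mul_pow, Real.sq_sqrt hd0.le, sq_abs]; exact hi
      exact le_of_pow_le_pow_left₀ two_ne_zero (by positivity) h1
    rw [div_le_div_iff₀ (by positivity) (by positivity)]
    calc euclidNorm x * (2 * L) ≤ Real.sqrt d * |((x i : ℤ) : ℝ)| * (2 * L) :=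
          mul_le_mul_of_nonneg_right hxi (by positivity)
      _ = |((x i : ℤ) : ℝ)| * (2 * L * Real.sqrt d) := by ring
  · refine Real.exp_le_exp.2 (neg_le_neg ?_)
    rw [div_le_div_iff₀ (by positivity) (by positivity)]
    calc euclidNorm x ^ 2 * (4 * soVariance d L * T) ≤ (d * ((x i : ℤ) : ℝ) ^ 2) * (4 * soVariance d L * T) :=
          mul_le_mul_of_nonneg_right hi (by positivity)
      _ = (d : ℝ) * ((x i : ℤ) : ℝ) ^ 2 * (4 * soVariance d L * T) := by ring

/-! ### The asymptotic formula -/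

/-- **Hara–van der Hofstad–Slade 2003, Prop. 1.3.1, second display, at fixed `L`** (the bound
beyond a radius): for `d ≥ 3`, `L ≥ 1` and `0 < α ≤ 1` there are `K` and `R₀` with
`|S_1(x) - (a_d/σ²)|x|^{2-d}| ≤ K |x|^{-(d-α)}` for all `|x| ≥ R₀`.
[cite: HaraHofstadSlade2003, Prop. 1.3.1 (6.3) and §6.5] [cite: Hara2008, Lemma 2.2] -/
theorem soGreen_one_sub_gaussian_le_of_le (hd : 3 ≤ d) (hL : 1 ≤ L) {α : ℝ} (hα : 0 < α) (hα1 : α ≤ 1) :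
    ∃ K R₀ : ℝ, ∀ x : Site d, R₀ ≤ euclidNorm x →
      |soGreen d L 1 x - gaussianAmp d / soVariance d L * euclidNorm x ^ (2 - (d : ℝ))| ≤
        K * euclidNorm x ^ (-((d : ℝ) - α)) := by
  have hd1 : 1 ≤ d := by omega
  have hd3 : (3 : ℝ) ≤ d := by exact_mod_cast hd
  have hd0 : (0 : ℝ) < d := by linarith
  have hL0 : (0 : ℝ) < L := by exact_mod_cast hL
  set σ : ℝ := soVariance d L with hσdef
  have hσ : 0 < σ := soVariance_pos hd1 hL
  -- exponents
  set δ : ℝ := 2 * α / d with hδ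
  have hδ0 : 0 < δ := by positivity
  have hδ1 : δ ≤ 1 := by
    rw [hδ, div_le_one hd0]; linarith
  have hδα : δ * d / 2 = α := by rw [hδ]; field_simp
  set a : ℝ := -(((d : ℝ) + 2) / 2) with ha
  have ha1 : a < -1 := by rw [ha]; linarith
  -- Hara's Lemma 2.2 for `J = D` at `ρ = 2`
  obtain ⟨c, hc⟩ := Hara2008_lem22_holds d hd (soStep d L) 2 (haraKernelHyp_soStep hd1 hL two_pos)
  rw [tsum_sq_mul_soStep] at hc
  have hc0 : 0 ≤ c := by
    have h := hc 1 le_rfl 0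
    rw [Real.one_rpow, mul_one] at h
    exact (norm_nonneg _).trans h
  have hmin : min (2 : ℝ) 2 = 2 := min_self _
  -- the decay rate `c₀` of the exponentially small pieces and their polynomial majorant
  set c₀ : ℝ := min (1 / (2 * L * Real.sqrt d)) (1 / (4 * σ)) with hc₀
  have hc₀0 : 0 < c₀ := lt_min (by positivity) (by positivity)
  set p : ℝ := 2 - δ + ((d : ℝ) - α) with hp
  have hp0 : 0 < p := by rw [hp]; linarith
  obtain ⟨C₁, hC₁0, hC₁⟩ := exists_rpow_mul_exp_neg_rpow_le hc₀0 hδ0 hp0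
  set A₀ : ℝ := ((d : ℝ) / (2 * Real.pi * σ)) ^ ((d : ℝ) / 2) with hA₀
  have hA₀0 : 0 ≤ A₀ := Real.rpow_nonneg (by positivity) _
  -- the constant and the radius
  refine ⟨2 * C₁ + A₀ * C₁ + c / (-(a + 1)), max 1 (σ ^ (1 / δ)), fun x hx => ?_⟩
  set r := euclidNorm x with hr
  have hr1 : 1 ≤ r := (le_max_left _ _).trans hx
  have hr0 : 0 < r := by linarith
  have hrσ : σ ≤ r ^ δ := by
    have h1 : σ ^ (1 / δ) ≤ r := (le_max_right _ _).trans hx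
    calc σ = (σ ^ (1 / δ)) ^ δ := by
          rw [← Real.rpow_mul hσ.le, one_div_mul_cancel hδ0.ne', Real.rpow_one]
      _ ≤ r ^ δ := Real.rpow_le_rpow (Real.rpow_nonneg hσ.le _) h1 hδ0.le
  set T : ℝ := r ^ (2 - δ) with hT
  have hT1 : 1 ≤ T := Real.one_le_rpow hr1 (by linarith)
  have hT0 : 0 < T := by linarith
  have hrT : r ^ 2 / T = r ^ δ := by
    rw [hT, div_eq_iff (Real.rpow_pos_of_pos hr0 _).ne', ← Real.rpow_natCast r 2, ← Real.rpow_add hr0]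
    congr 1; push_cast; ring
  have hTle : T ≤ r ^ 2 / σ := by
    -- `T σ ≤ T r^δ = r²`
    rw [le_div_iff₀ hσ]
    calc T * σ ≤ T * r ^ δ := mul_le_mul_of_nonneg_left hrσ hT0.le
      _ = r ^ 2 := by rw [← hrT]; field_simp
  -- the key polynomial bound `T e^{-c₀ r^δ} ≤ C₁ r^{-(d-α)}`
  have hkey : T * Real.exp (-(c₀ * r ^ δ)) ≤ C₁ * r ^ (-((d : ℝ) - α)) := by
    have h := hC₁ r hr0
    have hsplit : T = r ^ (-((d : ℝ) - α)) * r ^ p := by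
      rw [hT, ← Real.rpow_add hr0]; congr 1; rw [hp]; ring
    rw [hsplit, mul_assoc, mul_comm]
    exact mul_le_mul_of_nonneg_right h (Real.rpow_nonneg hr0.le _)
  -- the functions of `t`: `I t = soHeat d L 1 t x`, `G t = gaussMain d σ t r`
  obtain ⟨hI_int, hS⟩ := integral_soHeat_eq_soGreen hd hL zero_le_one le_rfl x
  have hG_int : IntegrableOn (fun t => gaussMain d σ t r) (Set.Ioi 0) := integrableOn_gaussMain hd hσ hr0
  have hG_tot : ∫ t in Set.Ioi (0 : ℝ), gaussMain d σ t r = gaussianAmp d / σ * r ^ (2 - (d : ℝ)) :=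
    integral_gaussMain hd hσ hr0
  -- (E1) small `t`
  have hE1 : 0 ≤ ∫ t in Set.Ioc 0 T, soHeat d L 1 t x ∧ ∫ t in Set.Ioc 0 T, soHeat d L 1 t x ≤ 2 * C₁ * r ^ (-((d : ℝ) - α)) := by
    refine ⟨setIntegral_nonneg measurableSet_Ioc fun t ht => soHeat_nonneg zero_le_one ht.1.le x, ?_⟩
    have h := integral_soHeat_Ioc_le_euclid hd1 hL zero_le_one le_rfl x hT0
    refine h.trans ?_
    have hex1 : Real.exp (-(r / (2 * L * Real.sqrt d))) ≤ Real.exp (-(c₀ * r ^ δ)) := by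
      refine Real.exp_le_exp.2 (neg_le_neg ?_)
      have hrδ : r ^ δ ≤ r := by
        have := Real.rpow_le_rpow_of_exponent_le hr1 hδ1
        rwa [Real.rpow_one] at this
      calc c₀ * r ^ δ ≤ 1 / (2 * L * Real.sqrt d) * r :=
            mul_le_mul (min_le_left _ _) hrδ (Real.rpow_nonneg hr0.le _) (by positivity)
        _ = r / (2 * L * Real.sqrt d) := by ring
    have hex2 : Real.exp (-(r ^ 2 / (4 * soVariance d L * T))) ≤ Real.exp (-(c₀ * r ^ δ)) := by
      refine Real.exp_le_exp.2 (neg_le_neg ?_)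
      rw [← hσdef, show r ^ 2 / (4 * σ * T) = 1 / (4 * σ) * (r ^ 2 / T) by field_simp, hrT]
      exact mul_le_mul_of_nonneg_right (min_le_right _ _) (Real.rpow_nonneg hr0.le _)
    calc T * (Real.exp (-(r / (2 * L * Real.sqrt d))) + Real.exp (-(r ^ 2 / (4 * soVariance d L * T))))
        ≤ T * (Real.exp (-(c₀ * r ^ δ)) + Real.exp (-(c₀ * r ^ δ))) := by gcongr
      _ = 2 * (T * Real.exp (-(c₀ * r ^ δ))) := by ring
      _ ≤ 2 * (C₁ * r ^ (-((d : ℝ) - α))) := by gcongr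
      _ = 2 * C₁ * r ^ (-((d : ℝ) - α)) := by ring
  -- (E2) the error of Lemma 2.2 beyond `T`
  have hdiff : ∀ t : ℝ, 1 ≤ t → |soHeat d L 1 t x - gaussMain d σ t r| ≤ c * t ^ a := by
    intro t ht
    have h := hc t ht x
    rw [hmin] at h
    calc |soHeat d L 1 t x - gaussMain d σ t r| = |(haraI (soStep d L) t x - (gaussMain d σ t r : ℂ)).re| := by
          rw [Complex.sub_re, Complex.ofReal_re, re_haraI_soStep]
      _ ≤ ‖haraI (soStep d L) t x - (gaussMain d σ t r : ℂ)‖ := Complex.abs_re_le_norm _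
      _ ≤ c * t ^ a := by rw [ha]; exact h
  have hIG_int : IntegrableOn (fun t => soHeat d L 1 t x - gaussMain d σ t r) (Set.Ioi T) :=
    (hI_int.mono_set (Set.Ioi_subset_Ioi hT0.le)).sub (hG_int.mono_set (Set.Ioi_subset_Ioi hT0.le))
  have hpow_int : IntegrableOn (fun t : ℝ => c * t ^ a) (Set.Ioi T) :=
    (integrableOn_Ioi_rpow_of_lt ha1 hT0).const_mul c
  have hE2 : |∫ t in Set.Ioi T, (soHeat d L 1 t x - gaussMain d σ t r)| ≤ c / (-(a + 1)) * r ^ (-((d : ℝ) - α)) := by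
    have h1 : |∫ t in Set.Ioi T, (soHeat d L 1 t x - gaussMain d σ t r)| ≤ ∫ t in Set.Ioi T, c * t ^ a := by
      rw [← Real.norm_eq_abs]
      refine norm_integral_le_of_norm_le hpow_int ?_
      refine (ae_restrict_iff' measurableSet_Ioi).2 (Filter.Eventually.of_forall fun t ht => ?_)
      rw [Real.norm_eq_abs]
      exact hdiff t (hT1.trans (le_of_lt ht))
    rw [integral_const_mul, integral_Ioi_rpow_of_lt ha1 hT0] at h1
    have hTa : T ^ (a + 1) = r ^ (-((d : ℝ) - α)) := by
      rw [hT, ← Real.rpow_mul hr0.le]; congr 1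
      rw [ha, ← hδα]; ring
    calc _ ≤ c * (-T ^ (a + 1) / (a + 1)) := h1
      _ = c / (-(a + 1)) * T ^ (a + 1) := by field_simp
      _ = c / (-(a + 1)) * r ^ (-((d : ℝ) - α)) := by rw [hTa]
  -- (E3) the Gaussian before `T`
  have hE3 : 0 ≤ ∫ t in Set.Ioc 0 T, gaussMain d σ t r ∧ ∫ t in Set.Ioc 0 T, gaussMain d σ t r ≤ A₀ * C₁ * r ^ (-((d : ℝ) - α)) := by
    refine ⟨setIntegral_nonneg measurableSet_Ioc fun t ht => gaussMain_nonneg d hσ.le ht.1.le r, ?_⟩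
    -- `gaussMain d σ t r ≤ gaussMain d σ T r ≤ A₀ e^{-c₀ r^δ}` on `(0, T]`
    have hGT : gaussMain d σ T r ≤ A₀ * Real.exp (-(c₀ * r ^ δ)) := by
      rw [gaussMain_eq d hσ hT0 r, ← hA₀]
      refine mul_le_mul_of_nonneg_left ?_ hA₀0
      have h1 : T ^ (-((d : ℝ) / 2)) ≤ 1 := Real.rpow_le_one_of_one_le_of_nonpos hT1 (by linarith)
      have h2 : Real.exp (-((d : ℝ) * r ^ 2 / (2 * σ) / T)) ≤ Real.exp (-(c₀ * r ^ δ)) := by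
        refine Real.exp_le_exp.2 (neg_le_neg ?_)
        rw [show (d : ℝ) * r ^ 2 / (2 * σ) / T = (d : ℝ) / (2 * σ) * (r ^ 2 / T) by field_simp, hrT]
        refine mul_le_mul_of_nonneg_right ((min_le_right _ _).trans ?_) (Real.rpow_nonneg hr0.le _)
        rw [div_le_div_iff₀ (by positivity) (by positivity)]
        nlinarith
      calc T ^ (-((d : ℝ) / 2)) * Real.exp (-((d : ℝ) * r ^ 2 / (2 * σ) / T))
          ≤ 1 * Real.exp (-(c₀ * r ^ δ)) := mul_le_mul h1 h2 (Real.exp_pos _).le zero_le_one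
        _ = Real.exp (-(c₀ * r ^ δ)) := one_mul _
    have hmono : ∀ t ∈ Set.Ioc (0 : ℝ) T, gaussMain d σ t r ≤ gaussMain d σ T r := fun t ht =>
      gaussMain_mono_of_le hd1 hσ hr0 ht.1 ht.2 hTle
    have hGc_int : IntegrableOn (fun t => gaussMain d σ t r) (Set.Ioc 0 T) := hG_int.mono_set Set.Ioc_subset_Ioi_self
    calc ∫ t in Set.Ioc 0 T, gaussMain d σ t r ≤ ∫ _ in Set.Ioc 0 T, gaussMain d σ T r :=
          setIntegral_mono_on hGc_int (integrableOn_const (by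
            rw [Real.volume_Ioc]; exact ENNReal.ofReal_ne_top)) measurableSet_Ioc hmono
      _ = T * gaussMain d σ T r := by rw [setIntegral_const, Real.volume_real_Ioc_of_le hT0.le, sub_zero, smul_eq_mul]
      _ ≤ T * (A₀ * Real.exp (-(c₀ * r ^ δ))) := mul_le_mul_of_nonneg_left hGT hT0.le
      _ = A₀ * (T * Real.exp (-(c₀ * r ^ δ))) := by ring
      _ ≤ A₀ * (C₁ * r ^ (-((d : ℝ) - α))) := mul_le_mul_of_nonneg_left hkey hA₀0
      _ = A₀ * C₁ * r ^ (-((d : ℝ) - α)) := by ring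
  -- the decomposition
  have hsplitI := integral_Ioi_eq_Ioc_add_Ioi_real hI_int hT0
  have hsplitG := integral_Ioi_eq_Ioc_add_Ioi_real hG_int hT0
  have hIoiT : ∫ t in Set.Ioi T, soHeat d L 1 t x = (∫ t in Set.Ioi T, gaussMain d σ t r) + ∫ t in Set.Ioi T, (soHeat d L 1 t x - gaussMain d σ t r) := by
    rw [← integral_add (hG_int.mono_set (Set.Ioi_subset_Ioi hT0.le)) hIG_int]
    refine integral_congr_ae (ae_of_all _ fun t => ?_)
    ring
  have hdecomp : soGreen d L 1 x - gaussianAmp d / σ * r ^ (2 - (d : ℝ)) =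
      (∫ t in Set.Ioc 0 T, soHeat d L 1 t x) + (∫ t in Set.Ioi T, (soHeat d L 1 t x - gaussMain d σ t r)) - ∫ t in Set.Ioc 0 T, gaussMain d σ t r := by
    rw [← hS, ← hG_tot, hsplitI, hIoiT, hsplitG]; ring
  rw [hdecomp]
  calc |(∫ t in Set.Ioc 0 T, soHeat d L 1 t x) + (∫ t in Set.Ioi T, (soHeat d L 1 t x - gaussMain d σ t r)) - ∫ t in Set.Ioc 0 T, gaussMain d σ t r|
      ≤ |∫ t in Set.Ioc 0 T, soHeat d L 1 t x| + |∫ t in Set.Ioi T, (soHeat d L 1 t x - gaussMain d σ t r)| + |∫ t in Set.Ioc 0 T, gaussMain d σ t r| :=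
        (abs_sub _ _).trans (add_le_add (abs_add_le _ _) le_rfl)
    _ ≤ 2 * C₁ * r ^ (-((d : ℝ) - α)) + c / (-(a + 1)) * r ^ (-((d : ℝ) - α)) +
          A₀ * C₁ * r ^ (-((d : ℝ) - α)) := by
        refine add_le_add (add_le_add ?_ hE2) ?_
        · rw [abs_of_nonneg hE1.1]; exact hE1.2
        · rw [abs_of_nonneg hE3.1]; exact hE3.2
    _ = (2 * C₁ + A₀ * C₁ + c / (-(a + 1))) * r ^ (-((d : ℝ) - α)) := by ring

/-- **Hara–van der Hofstad–Slade 2003, Prop. 1.3.1, second display, at fixed `L`, for all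
`x ≠ 0`**: for `d ≥ 3`, `L ≥ 1` and every `α > 0` there is `K` with
`|S_1(x) - (a_d/σ²)|x|^{2-d}| ≤ K |x|^{-(d-α)}` for all `x ≠ 0` — the sharp Gaussian asymptotics of
the spread-out Green function ("`S_1(x) = (a_d/σ²)|x|^{2-d} + O(|x|^{-(d-α)})`"), the error being
smaller than any `|x|^{-(d-2+s)}`, `s < 2`. [cite: HaraHofstadSlade2003, Prop. 1.3.1 (6.3) and §6.5]
[cite: Sakai2007, (1.19) (S_τ and its Gaussian behaviour)] -/
theorem soGreen_one_asymp_sharp (hd : 3 ≤ d) (hL : 1 ≤ L) {α : ℝ} (hα : 0 < α) :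
    ∃ K : ℝ, ∀ x : Site d, x ≠ 0 →
      |soGreen d L 1 x - gaussianAmp d / soVariance d L * euclidNorm x ^ (2 - (d : ℝ))| ≤
        K * euclidNorm x ^ (-((d : ℝ) - α)) := by
  -- reduce to `α' = min α 1`
  set α' : ℝ := min α 1 with hα'
  have hα'0 : 0 < α' := lt_min hα one_pos
  have hα'1 : α' ≤ 1 := min_le_right _ _
  have hα'α : α' ≤ α := min_le_left _ _
  obtain ⟨K, R₀, hK⟩ := soGreen_one_sub_gaussian_le_of_le hd hL hα'0 hα'1
  obtain ⟨K', hK'⟩ := exists_forall_ne_zero_of_forall_le_norm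
    (f := fun x => soGreen d L 1 x - gaussianAmp d / soVariance d L * euclidNorm x ^ (2 - (d : ℝ)))
    (g := fun x => euclidNorm x ^ (-((d : ℝ) - α')))
    (fun x hx => Real.rpow_pos_of_pos (lt_of_lt_of_le one_pos (one_le_euclidNorm_of_ne_zero hx)) _) hK
  refine ⟨max K' 0, fun x hx => ?_⟩
  have h1 : 1 ≤ euclidNorm x := one_le_euclidNorm_of_ne_zero hx
  have h := hK' x hx
  refine h.trans ?_
  calc K' * euclidNorm x ^ (-((d : ℝ) - α')) ≤ max K' 0 * euclidNorm x ^ (-((d : ℝ) - α')) :=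
        mul_le_mul_of_nonneg_right (le_max_left _ _) (Real.rpow_nonneg (by linarith) _)
    _ ≤ max K' 0 * euclidNorm x ^ (-((d : ℝ) - α)) := by
        refine mul_le_mul_of_nonneg_left ?_ (le_max_right _ _)
        exact Real.rpow_le_rpow_of_exponent_le h1 (by linarith)

end Literature.Barriers.CriticalPhenomena.SpreadOutIsing

end
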